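import Mathlib
import HarnessLib.Audit
import Summits.PneNP.PneNP.Theorems.PstarGateCaseTPairExc
import Summits.PneNP.PneNP.Theorems.PstarGateCaseTCycle
import Summits.PneNP.PneNP.Theorems.PstarGateHyperplane
import Summits.PneNP.PneNP.Theorems.PstarChordBridgeKill
import Summits.PneNP.PneNP.Theorems.PstarChordBridgeExchange

/-!
# One GATED chord, CASE T: the coupled structure — polarity one, triangles, at most two other chords (E2; prover-1 g19)

FRONTIER range-avoidance ladder, rung F-N3 (`stmt-PneNP-19007`), cell `pnp-ideate` (`PstarGateNodesX`, nodes N3/N4); restricted-model proof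
complexity — nothing here bears on `P` versus `NP`.

CASE T with at least one other chord.  By `PstarGateCaseTPairExc.caseT_coupled` every other chord `e'` satisfies `u_{e'} = u_e + 1` on the gate
chamber, so `Q_{D e ∆ D e'}` is constant there: every edge of `M := D e ∆ D e'` passes through `u` and the polarity is `κ₀ = 1`
(`PstarGateHyperplane.const_on_hyperplane`; `κ₀ = 0` would force `D e = D e'`).  `M` has at most two edges (`card_symmDiff_le_two`), and NOT two:
the square `{m, m', e, e'}` plus the gate `g₀` is a five-member family with at most `7 < 7.5` boundary variables.  So `M = {m}`: a triangle
`{e, e', m}`, with `m` through an endpoint of `e` (a vertex of `M` is an endpoint of exactly one of `e, e'`; both endpoints in `e'` would make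
`m, e'` share two variables); two `u`-edges cannot share an XOR vertex (`matching_of_through`), so:

* `caseT_kappa_one`, `caseT_diff_single`, `caseT_card_others_le_two` — **`κ₀ = 1`; `D e ∆ D e' = {m}` with `m ∋ u` meeting `xpair e`; `#(N ∖ e) ≤ 2`.**
-/

set_option linter.dupNamespace false -- `Summit.PneNP.PneNP.…`: summit = sub-problem name (D-0017 single-conjunct layout)

open Finset Literature.Computability.Complexity
open scoped symmDiff
open Summit.PneNP.PneNP.Theorems.PstarTyped (Typed)
open Summit.PneNP.PneNP.Theorems.PstarSALevel (varSet bdry BoundaryExpanding SimpleOverlap)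
open Summit.PneNP.PneNP.Theorems.PstarCentreFree (vars_mem_varSet)
open Summit.PneNP.PneNP.Theorems.PstarXCore (xpair xverts mem_xpair)
open Summit.PneNP.PneNP.Theorems.PstarProductRank (qform)
open Summit.PneNP.PneNP.Theorems.PstarReadSumset (V2)
open Summit.PneNP.PneNP.Theorems.PstarChordSystem (ChordSystem)
open Summit.PneNP.PneNP.Theorems.PstarChordEndgameTools (not_two_shared)
open Summit.PneNP.PneNP.Theorems.PstarChordBridgeTools (privs coef xpdeg)
open Summit.PneNP.PneNP.Theorems.PstarChordBridge (BridgeData sys)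
open Summit.PneNP.PneNP.Theorems.PstarChordBridgeForcing (gam sys_u_eq)
open Summit.PneNP.PneNP.Theorems.PstarChordBridgeFundamental (eq_of_fundamental_eq)
open Summit.PneNP.PneNP.Theorems.PstarChordBridgeExchange (even_xpdeg_symmDiff insert_symmDiff_of_not_mem)
open Summit.PneNP.PneNP.Theorems.PstarChordBridgeKill (qform_symmDiff)
open Summit.PneNP.PneNP.Theorems.PstarNorCoreTools (not_mem_bdry_of_two card_varSet_inter_bdry_le card_bdry_le_sum)
open Summit.PneNP.PneNP.Theorems.PstarNorUnitBridge (xor_not_mem_bdry_of_even)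
open Summit.PneNP.PneNP.Theorems.PstarGateBridge (GateHyp)
open Summit.PneNP.PneNP.Theorems.PstarGateHyperplane (const_on_hyperplane)
open Summit.PneNP.PneNP.Theorems.PstarGateCaseTCycle (card_symmDiff_le_two mem_xpair_xor_of_mem_xverts matching_of_through)
open Summit.PneNP.PneNP.Theorems.PstarGateCasePNorHolders (not_mem_bdry_sup card_three_slots)
open Summit.PneNP.PneNP.Theorems.PstarGateNodes (GateData)
open Summit.PneNP.PneNP.Theorems.PstarGateNodesX (GateDataX)
open Summit.PneNP.PneNP.Theorems.PstarGateCaseTPairExc (caseT_coupled)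

namespace Summit.PneNP.PneNP.Theorems.PstarGateCaseTStructure

variable {n m : ℕ}

section Structure

variable (I : LocalMap 4 n m) (hI : I.IsPure xorAndPred) (hT : Typed I) (hS : SimpleOverlap I) {r₀ : ℕ} (hB : BoundaryExpanding r₀ I)
  {B : BridgeData n m} {e g₀ : Fin m} {u : Fin n} {κ₀ : ZMod 2} (hD : GateDataX I r₀ B e g₀ u κ₀) {mv : V2} (hmvT : mv = (0, 1) ∨ mv = (1, 1))
  (hP : ∀ e' ∈ B.N, e' ≠ e → ∀ a, ((sys I B).ρ e' a = 0 ∨ (sys I B).ρ e' a = mv) ∧ ((sys I B).ρ' e' a = 0 ∨ (sys I B).ρ' e' a = mv))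
  (hread : ∀ e' ∈ B.N, e' ≠ e → ∀ a, (sys I B).ρ e' a ≠ 0 ∨ (sys I B).ρ' e' a ≠ 0)
include hI hT hS hB hD hmvT hP hread

/-- **Coupling makes `Q_{D e ∆ D e'}` constant on the chamber: its edges pass through `u`, and `κ₀ = 1`.** -/
theorem caseT_through {e' : Fin m} (he' : e' ∈ B.N) (hne : e' ≠ e) :
    (∀ j ∈ B.D e ∆ B.D e', I.vars j 2 = u ∨ I.vars j 3 = u) ∧ κ₀ = 1 := by
  classical
  obtain ⟨-, hW, -, -, -, -, -, -, hG, -⟩ := id hD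
  have he : e ∈ B.N := hG.1
  have hcpl := caseT_coupled I hI hT hS hB hD hmvT he' hne (hP e' he' hne) (hread e' he' hne)
  have hconst : ∀ x : Fin n → ZMod 2, x u = κ₀ + 1 →
      qform (B.D e ∆ B.D e') (fun j => I.vars j 2) (fun j => I.vars j 3) x = 1 + gam B e + gam B e' := by
    intro x hx
    have h := hcpl x hx
    rw [sys_u_eq, sys_u_eq] at h
    rw [qform_symmDiff]
    have e3 : ∀ g Q g' Q' : ZMod 2, g' + Q' = g + Q + 1 → Q + Q' = 1 + g + g' := by decide
    exact e3 _ _ _ _ h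
  obtain ⟨hthrough, hone⟩ := const_on_hyperplane I hI hS (B.D e ∆ B.D e') u (κ₀ + 1) _ hconst
  refine ⟨hthrough, ?_⟩
  by_contra hκ
  have hempty := hone (by revert hκ; generalize κ₀ = k; revert k; decide)
  have heD : e ∉ B.D e := fun h => (mem_sdiff.1 (hW.hD e he h)).2 he
  have he'D : e' ∉ B.D e := fun h => (mem_sdiff.1 (hW.hD e he h)).2 he'
  have hDD : B.D e = B.D e' := Finset.symmDiff_eq_empty.1 hempty
  have hev' : ∀ w, Even (xpdeg I (insert e' (B.D e)) w) := fun w => by rw [hDD]; exact hW.hDeven e' he' w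
  exact hne (eq_of_fundamental_eq I hI hS heD he'D (hW.hDeven e he) hev').symm

/-- **The difference is a single `u`-edge through an endpoint of `e`** (the square is killed by expansion). -/
theorem caseT_diff_single {e' : Fin m} (he' : e' ∈ B.N) (hne : e' ≠ e) :
    ∃ m₀ : Fin m, B.D e ∆ B.D e' = {m₀} ∧ (I.vars m₀ 2 = u ∨ I.vars m₀ 3 = u) ∧ (I.vars m₀ 0 ∈ xpair I e ∨ I.vars m₀ 1 ∈ xpair I e) := by
  classical
  obtain ⟨-, hW, hr, hd₁, -, -, -, -, hG, hg₀, hgv, -⟩ := id hD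
  have he : e ∈ B.N := hG.1
  have heJ : e ∈ B.J₀ := hW.hN he
  have he'J : e' ∈ B.J₀ := hW.hN he'
  have hg₀J : g₀ ∉ B.J₀ := fun h => disjoint_left.1 hd₁ hg₀ h
  have heD : e ∉ B.D e := fun h => (mem_sdiff.1 (hW.hD e he h)).2 he
  have he'D' : e' ∉ B.D e' := fun h => (mem_sdiff.1 (hW.hD e' he' h)).2 he'
  have he'D : e' ∉ B.D e := fun h => (mem_sdiff.1 (hW.hD e he h)).2 he'
  have heD' : e ∉ B.D e' := fun h => (mem_sdiff.1 (hW.hD e' he' h)).2 he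
  obtain ⟨hM, hκ⟩ := caseT_through I hI hT hS hB hD hmvT hP hread he' hne
  set M := B.D e ∆ B.D e' with hMdef
  have hMle : M.card ≤ 2 := card_symmDiff_le_two I hI hS heD he'D' (hW.hDeven e he) (hW.hDeven e' he') hM
  have hMF : M ⊆ B.J₀ \ B.N := fun j hj => by
    rcases Finset.mem_symmDiff.1 hj with ⟨h, -⟩ | ⟨h, -⟩
    · exact hW.hD e he h
    · exact hW.hD e' he' h
  -- `M` is non-empty
  have hMne : M ≠ ∅ := by
    intro h0
    have hDD : B.D e = B.D e' := Finset.symmDiff_eq_empty.1 h0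
    have hev' : ∀ w, Even (xpdeg I (insert e' (B.D e)) w) := fun w => by rw [hDD]; exact hW.hDeven e' he' w
    exact hne (eq_of_fundamental_eq I hI hS heD he'D (hW.hDeven e he) hev').symm
  -- parity: `S := {e, e'} ∪ M` has even XOR degrees
  have hSeq : insert e (insert e' M) = (insert e (B.D e)) ∆ (insert e' (B.D e')) := by
    rw [hMdef]
    ext j
    simp only [mem_insert, Finset.mem_symmDiff]
    constructor
    · rintro (rfl | rfl | ⟨h1, h2⟩ | ⟨h1, h2⟩)
      · exact Or.inl ⟨Or.inl rfl, fun h => h.elim (fun h => hne h.symm) heD'⟩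
      · exact Or.inr ⟨Or.inl rfl, fun h => h.elim (fun h => hne h) he'D⟩
      · exact Or.inl ⟨Or.inr h1, fun h => h.elim (fun h => (mem_sdiff.1 (hW.hD e he h1)).2 (h ▸ he')) h2⟩
      · exact Or.inr ⟨Or.inr h1, fun h => h.elim (fun h => (mem_sdiff.1 (hW.hD e' he' h1)).2 (h ▸ he)) h2⟩
    · rintro (⟨h1 | h1, h2⟩ | ⟨h1 | h1, h2⟩)
      · exact Or.inl h1
      · exact Or.inr (Or.inr (Or.inl ⟨h1, fun h => h2 (Or.inr h)⟩))
      · exact Or.inr (Or.inl h1)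
      · exact Or.inr (Or.inr (Or.inr ⟨h1, fun h => h2 (Or.inr h)⟩))
  have hSeven : ∀ w, Even (xpdeg I (insert e (insert e' M)) w) := by
    intro w; rw [hSeq]; exact even_xpdeg_symmDiff I (hW.hDeven e he) (hW.hDeven e' he') w
  -- not two edges: the square plus the gate violates expansion
  have hM1 : M.card = 1 := by
    have hpos : 0 < M.card := card_pos.2 (nonempty_iff_ne_empty.2 hMne)
    by_contra h1
    have hM2 : M.card = 2 := by omega
    obtain ⟨m₁, m₂, hne12, hMeq⟩ := card_eq_two.1 hM2
    have hm₁M : m₁ ∈ M := by rw [hMeq]; exact mem_insert_self _ _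
    have hm₂M : m₂ ∈ M := by rw [hMeq]; exact mem_insert_of_mem (mem_singleton_self _)
    set Y : Finset (Fin m) := insert g₀ (insert e (insert e' M)) with hYdef
    have hSY : insert e (insert e' M) ⊆ Y := subset_insert _ _
    have heM : e ∉ insert e' M := by
      rw [mem_insert, not_or]; exact ⟨Ne.symm hne, fun h => (mem_sdiff.1 (hMF h)).2 he⟩
    have he'M : e' ∉ M := fun h => (mem_sdiff.1 (hMF h)).2 he'
    have hg₀Y : g₀ ∉ insert e (insert e' M) := by
      rw [mem_insert, mem_insert, not_or, not_or]
      exact ⟨fun h => hg₀J (h ▸ heJ), fun h => hg₀J (h ▸ he'J), fun h => hg₀J ((mem_sdiff.1 (hMF h)).1)⟩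
    have hYcard : Y.card = 5 := by
      rw [hYdef, card_insert_of_notMem hg₀Y, card_insert_of_notMem heM, card_insert_of_notMem he'M, hM2]
    have hYr : Y.card ≤ r₀ := by
      refine (card_le_card ?_).trans hr
      refine insert_subset (mem_union_left _ (mem_union_right _ hg₀)) (insert_subset ?_ (insert_subset ?_ fun j hj => ?_))
      · exact mem_union_left _ (mem_union_left _ heJ)
      · exact mem_union_left _ (mem_union_left _ he'J)
      · exact mem_union_left _ (mem_union_left _ (mem_sdiff.1 (hMF hj)).1)
    have hg₀Y' : g₀ ∈ Y := mem_insert_self _ _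
    have heY : e ∈ Y := mem_insert_of_mem (mem_insert_self _ _)
    have he'Y : e' ∈ Y := mem_insert_of_mem (mem_insert_of_mem (mem_insert_self _ _))
    have hMY : ∀ j ∈ M, j ∈ Y := fun j hj => mem_insert_of_mem (mem_insert_of_mem (mem_insert_of_mem hj))
    have hxor : ∀ j ∈ insert e (insert e' M), ∀ s : Fin 4, s.val < 2 → I.vars j s ∉ bdry I Y := fun j hj s hs =>
      not_mem_bdry_sup I hSY hj (vars_mem_varSet I j s) (xor_not_mem_bdry_of_even I hI hSeven j hj s hs)
    have hu_of : ∀ j ∈ M, u ∈ varSet I j := fun j hj => by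
      rcases hM j hj with h | h <;> rw [← h] <;> exact vars_mem_varSet I j _
    have hp_g₀ : I.vars e 2 ∈ varSet I g₀ := by rcases hgv with ⟨h, -⟩ | ⟨-, h⟩ <;> exact h ▸ vars_mem_varSet I g₀ _
    have hu_g₀ : u ∈ varSet I g₀ := by rcases hgv with ⟨-, h⟩ | ⟨h, -⟩ <;> exact h ▸ vars_mem_varSet I g₀ _
    let q : Fin m → ℕ := fun k => if k = e' then 2 else if k = g₀ then 2 else 1
    have hq : ∀ k ∈ Y, (varSet I k ∩ bdry I Y).card ≤ q k := by
      intro k hk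
      by_cases hke' : k = e'
      · subst hke'
        simp only [q, if_true]
        have h := card_varSet_inter_bdry_le I Y k {0, 1} (fun s hs => by
          simp only [mem_insert, mem_singleton] at hs
          rcases hs with rfl | rfl <;> exact hxor k (mem_insert_of_mem (mem_insert_self _ _)) _ (by decide))
        rw [show ({0, 1} : Finset (Fin 4)).card = 2 by decide] at h; exact h
      by_cases hkg₀ : k = g₀
      · subst hkg₀
        simp only [q, if_neg hke', if_true]
        have h := card_varSet_inter_bdry_le I Y k {2, 3} (fun s hs => by
          simp only [mem_insert, mem_singleton] at hs
          rcases hs with rfl | rfl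
          · rcases hgv with ⟨h2, -⟩ | ⟨h2, -⟩
            · exact not_mem_bdry_of_two I hk heY (fun h => hg₀J (h ▸ heJ)) (vars_mem_varSet I k 2) (h2 ▸ vars_mem_varSet I e 2)
            · exact not_mem_bdry_of_two I hk (hMY m₁ hm₁M) (fun h => hg₀J (h ▸ (mem_sdiff.1 (hMF hm₁M)).1)) (vars_mem_varSet I k 2)
                (h2 ▸ hu_of m₁ hm₁M)
          · rcases hgv with ⟨-, h3⟩ | ⟨-, h3⟩
            · exact not_mem_bdry_of_two I hk (hMY m₁ hm₁M) (fun h => hg₀J (h ▸ (mem_sdiff.1 (hMF hm₁M)).1)) (vars_mem_varSet I k 3)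
                (h3 ▸ hu_of m₁ hm₁M)
            · exact not_mem_bdry_of_two I hk heY (fun h => hg₀J (h ▸ heJ)) (vars_mem_varSet I k 3) (h3 ▸ vars_mem_varSet I e 2))
        rw [show ({2, 3} : Finset (Fin 4)).card = 2 by decide] at h; exact h
      simp only [q, if_neg hke', if_neg hkg₀]
      have hk' : k ∈ insert e (insert e' M) := by
        rw [hYdef, mem_insert] at hk
        rcases hk with h | h
        · exact absurd h hkg₀
        · exact h
      -- `e` loses `p` to the gate; an edge of `M` loses `u` to the gate
      obtain ⟨s, hs2, k', hk'Y, hnek, hv⟩ : ∃ s : Fin 4, 2 ≤ s.val ∧ ∃ k' ∈ Y, k' ≠ k ∧ I.vars k s ∈ varSet I k' := by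
        rw [mem_insert, mem_insert] at hk'
        rcases hk' with rfl | rfl | hkM
        · exact ⟨2, by decide, g₀, hg₀Y', fun h => hg₀J (h ▸ heJ), hp_g₀⟩
        · exact absurd rfl hke'
        · rcases hM k hkM with h | h
          · exact ⟨2, by decide, g₀, hg₀Y', fun h' => hg₀J (h' ▸ (mem_sdiff.1 (hMF hkM)).1), h ▸ hu_g₀⟩
          · exact ⟨3, by decide, g₀, hg₀Y', fun h' => hg₀J (h' ▸ (mem_sdiff.1 (hMF hkM)).1), h ▸ hu_g₀⟩
      have h := card_varSet_inter_bdry_le I Y k {0, 1, s} (fun s' hs' => by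
        simp only [mem_insert, mem_singleton] at hs'
        rcases hs' with rfl | rfl | rfl
        · exact hxor k hk' 0 (by decide)
        · exact hxor k hk' 1 (by decide)
        · exact not_mem_bdry_of_two I hk hk'Y (Ne.symm hnek) (vars_mem_varSet I k s') hv)
      rw [card_three_slots hs2] at h; exact h
    have hbd := card_bdry_le_sum I Y q hq
    have hsum : ∑ k ∈ Y, q k = 2 + (1 + (2 + M.card)) := by
      rw [hYdef, sum_insert hg₀Y, sum_insert heM, sum_insert he'M]
      have hg₀e' : g₀ ≠ e' := fun h => hg₀J (h ▸ he'J)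
      have heg₀ : e ≠ g₀ := fun h => hg₀J (h ▸ heJ)
      have hqg₀ : q g₀ = 2 := by
        show (if g₀ = e' then 2 else if g₀ = g₀ then 2 else 1) = 2
        rw [if_neg hg₀e', if_pos rfl]
      have hqe : q e = 1 := by
        show (if e = e' then 2 else if e = g₀ then 2 else 1) = 1
        rw [if_neg (Ne.symm hne), if_neg heg₀]
      have hqe' : q e' = 2 := by
        show (if e' = e' then 2 else if e' = g₀ then 2 else 1) = 2
        rw [if_pos rfl]
      have hqM : ∑ k ∈ M, q k = M.card := by
        rw [card_eq_sum_ones]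
        refine sum_congr rfl fun k hk => ?_
        have hke' : k ≠ e' := fun h => he'M (h ▸ hk)
        have hkg₀ : k ≠ g₀ := fun h => hg₀J (h ▸ (mem_sdiff.1 (hMF hk)).1)
        show (if k = e' then 2 else if k = g₀ then 2 else 1) = 1
        rw [if_neg hke', if_neg hkg₀]
      rw [hqg₀, hqe, hqe', hqM]
    have hexp := hB Y hYr
    rw [hYcard] at hexp
    rw [hsum, hM2] at hbd
    omega
  obtain ⟨m₀, hMeq⟩ := card_eq_one.1 hM1
  have hm₀M : m₀ ∈ M := by rw [hMeq]; exact mem_singleton_self _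
  refine ⟨m₀, hMeq, hM m₀ hm₀M, ?_⟩
  -- `m₀` passes through an endpoint of `e`: else both its endpoints are endpoints of `e'`
  have hvert : ∀ w ∈ xpair I m₀, (w ∈ xpair I e ∧ w ∉ xpair I e') ∨ (w ∉ xpair I e ∧ w ∈ xpair I e') := by
    intro w hw
    have hwM : w ∈ xverts I M := by
      unfold PstarXCore.xverts; exact mem_biUnion.2 ⟨m₀, hm₀M, hw⟩
    exact mem_xpair_xor_of_mem_xverts I hI hS heD he'D' (hW.hDeven e he) (hW.hDeven e' he') hM hwM
  by_contra hno
  push Not at hno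
  obtain ⟨h0, h1⟩ := hno
  have h0' := (hvert _ ((mem_xpair I).2 (Or.inl rfl))).resolve_left (fun h => h0 h.1)
  have h1' := (hvert _ ((mem_xpair I).2 (Or.inr rfl))).resolve_left (fun h => h1 h.1)
  have h01 : I.vars m₀ 0 ≠ I.vars m₀ 1 := fun h => absurd (hI.2 m₀ h) (by decide)
  have hm₀e' : m₀ ≠ e' := fun h => (mem_sdiff.1 (hMF hm₀M)).2 (h ▸ he')
  have hxs : ∀ {i : Fin m} {v : Fin n}, v ∈ xpair I i → v ∈ varSet I i := by
    intro i v hv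
    rcases (mem_xpair I).1 hv with rfl | rfl
    · exact vars_mem_varSet I i 0
    · exact vars_mem_varSet I i 1
  exact not_two_shared I hS hm₀e' h01 (vars_mem_varSet I m₀ 0) (hxs h0'.2) (vars_mem_varSet I m₀ 1) (hxs h1'.2)

/-- **At most two other chords** (their `u`-edges pass through distinct endpoints of `e`). -/
theorem caseT_card_others_le_two : (B.N.erase e).card ≤ 2 := by
  classical
  obtain ⟨-, hW, -, -, -, -, -, -, hG, -⟩ := id hD
  have he : e ∈ B.N := hG.1
  have heD : e ∉ B.D e := fun h => (mem_sdiff.1 (hW.hD e he h)).2 he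
  by_contra h3
  have h3' : 2 < (B.N.erase e).card := by omega
  obtain ⟨e₁, he₁, e₂, he₂, e₃, he₃, h12, h13, h23⟩ := two_lt_card.1 h3'
  -- the `u`-edges of three chords: two of them pass through the same endpoint of `e`
  have key : ∀ {c : Fin m}, c ∈ B.N.erase e → ∃ m₀ : Fin m, B.D e ∆ B.D c = {m₀} ∧ (I.vars m₀ 2 = u ∨ I.vars m₀ 3 = u) ∧
      (I.vars m₀ 0 ∈ xpair I e ∨ I.vars m₀ 1 ∈ xpair I e) :=
    fun hc => caseT_diff_single I hI hT hS hB hD hmvT hP hread (mem_of_mem_erase hc) (ne_of_mem_erase hc)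
  obtain ⟨n₁, hM₁, hu₁, hx₁⟩ := key he₁
  obtain ⟨n₂, hM₂, hu₂, hx₂⟩ := key he₂
  obtain ⟨n₃, hM₃, hu₃, hx₃⟩ := key he₃
  -- distinct chords have distinct `u`-edges
  have hdist : ∀ {c c' : Fin m} {k k' : Fin m}, c ∈ B.N.erase e → c' ∈ B.N.erase e → c ≠ c' →
      B.D e ∆ B.D c = {k} → B.D e ∆ B.D c' = {k'} → k ≠ k' := by
    intro c c' k k' hc hc' hcc' hk hk' hkk
    subst hkk
    have hDD : B.D c = B.D c' := by
      have h1 : B.D c = B.D e ∆ {k} := by rw [← hk, ← symmDiff_assoc, symmDiff_self, bot_symmDiff]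
      have h2 : B.D c' = B.D e ∆ {k} := by rw [← hk', ← symmDiff_assoc, symmDiff_self, bot_symmDiff]
      rw [h1, h2]
    have hcN := mem_of_mem_erase hc
    have hc'N := mem_of_mem_erase hc'
    have hcD : c ∉ B.D c := fun h => (mem_sdiff.1 (hW.hD c hcN h)).2 hcN
    have hc'D : c' ∉ B.D c := fun h => (mem_sdiff.1 (hW.hD c hcN h)).2 hc'N
    have hev' : ∀ w, Even (xpdeg I (insert c' (B.D c)) w) := fun w => by rw [hDD]; exact hW.hDeven c' hc'N w
    exact hcc' (eq_of_fundamental_eq I hI hS hcD hc'D (hW.hDeven c hcN) hev')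
  have hn12 := hdist he₁ he₂ h12 hM₁ hM₂
  have hn13 := hdist he₁ he₃ h13 hM₁ hM₃
  have hn23 := hdist he₂ he₃ h23 hM₂ hM₃
  -- a common endpoint of `e` on two distinct `u`-edges contradicts `matching_of_through`
  have clash : ∀ {k k' : Fin m}, k ≠ k' → (I.vars k 2 = u ∨ I.vars k 3 = u) → (I.vars k' 2 = u ∨ I.vars k' 3 = u) →
      ∀ w, w ∈ xpair I k → w ∈ xpair I k' → False :=
    fun hkk hk hk' w hw hw' => matching_of_through I hI hS hkk hk hk' hw hw'
  have hmem : ∀ {k : Fin m} {s : Fin 4}, (s = 0 ∨ s = 1) → I.vars k s ∈ xpair I k := by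
    intro k s hs
    rcases hs with rfl | rfl
    · exact (mem_xpair I).2 (Or.inl rfl)
    · exact (mem_xpair I).2 (Or.inr rfl)
  -- endpoints of `e`: `a = vars e 0`, `b = vars e 1`; each `nᵢ` contains `a` or `b`
  have hend : ∀ {k : Fin m}, (I.vars k 0 ∈ xpair I e ∨ I.vars k 1 ∈ xpair I e) → I.vars e 0 ∈ xpair I k ∨ I.vars e 1 ∈ xpair I k := by
    intro k hk
    rcases hk with h | h
    · rcases (mem_xpair I).1 h with h' | h'
      · exact Or.inl (h' ▸ hmem (Or.inl rfl))
      · exact Or.inr (h' ▸ hmem (Or.inl rfl))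
    · rcases (mem_xpair I).1 h with h' | h'
      · exact Or.inl (h' ▸ hmem (Or.inr rfl))
      · exact Or.inr (h' ▸ hmem (Or.inr rfl))
  rcases hend hx₁ with ha₁ | hb₁ <;> rcases hend hx₂ with ha₂ | hb₂ <;> rcases hend hx₃ with ha₃ | hb₃
  · exact clash hn12 hu₁ hu₂ _ ha₁ ha₂
  · exact clash hn12 hu₁ hu₂ _ ha₁ ha₂
  · exact clash hn13 hu₁ hu₃ _ ha₁ ha₃
  · exact clash hn23 hu₂ hu₃ _ hb₂ hb₃
  · exact clash hn23 hu₂ hu₃ _ ha₂ ha₃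
  · exact clash hn13 hu₁ hu₃ _ hb₁ hb₃
  · exact clash hn12 hu₁ hu₂ _ hb₁ hb₂
  · exact clash hn12 hu₁ hu₂ _ hb₁ hb₂

end Structure

end Summit.PneNP.PneNP.Theorems.PstarGateCaseTStructure
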